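import Literature.Geometry.Riemannian.LowerVolumeBoundHCenter
import Literature.Geometry.Riemannian.HeatKernelEntropyLowerPoint
import HarnessLib

/-!
# A point near an `H_m`-centre where the conjugate heat kernel is not small
# (Bamler 2020a, §7.3, proof of the Gaussian lemma, the step after (7.19))

R. Bamler, *Entropy and heat kernel bounds on a Ricci flow background*, arXiv:2008.07093 (2020a),
§7.3, proof of the a-priori Gaussian bound (arXiv v1: Lemma 28), right after (7.19): "By
combining Propositions 3.13, 5.13 we obtain that there is a point `y₂ ∈ B(z, 0, √(2H_n))` with
`(f(y₂) − 𝒩*_0(x,1) − n/2)² ≤ 2(n − 2 R_min τ)`. Thus `K(x,1;y₂,0) ≥ c exp(−𝒩*_0(x,1))`."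

This file PROVES this step (`exists_near_hCenter_le_heatKernelFn`) at a general scale, for a
Ricci flow `hflow = (h, cov)` on `[a, T]` of a `C^∞` family of Riemannian metrics on a closed
connected manifold `M` modelled on `ℝᵐ`, `m ≥ 3`, `a < s < t ≤ T`, `τ = t − s`, the conjugate
heat kernel `K = hflow.heatKernelFn hh hR` (`RicciFlowHeatKernelFn.lean`) written as
`K(x,t;·,s) = (4πτ)^{-m/2} e^{-f}` (`f = entropyPotential`), the conjugate heat kernel measure
`ν = ν_{x,t;s} = K dg_s` (`heatKernelMeasure`), the pointed Nash entropy
`𝒩 = pointedNashEntropy h (K t x (·, ·)) m t s`, a lower scalar curvature bound `R(·, s) ≥ R_min`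
with `−R_min τ ≤ Λ`, `Λ ≥ 0`, and an `H_m`-centre `z` of `(x, t)` at time `s` in the variance
form `∫ d_s(z, ·)² dν ≤ H_m τ`, `H_m = (m − 1)π²/2 + 4`: there is a point `y₂` with

  `d_s(z, y₂) < √(2 H_m τ)` and `K(x,t;y₂,s) ≥ (4πτ)^{-m/2} exp(−𝒩 − m/2 − √(2m + 4Λ + 2))`.

Proof (Bamler): Chebyshev for the variance bound (Prop. 3.11 with `A = 2`, for the closed
complement `{√(2 H_m τ) ≤ d_s(z, ·)}`, `measure_setOf_sqrt_le_le_half`) gives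
`ν(B(z, √(2H_mτ))) ≥ 1/2`; Markov for `(f − 𝒩 − m/2)²`, whose `ν`-integral is `≤ m − 2 R_min τ`
(Prop. 5.13, `IsRicciFlow.integral_sq_entropyPotential_sub_kernel_le`), at the level
`L = 2m + 4Λ + 2 > 2(m − 2 R_min τ)` gives `ν{(f − 𝒩 − m/2)² < L} > 1/2`; so the two sets meet,
and at a common point `f(y₂) < 𝒩 + m/2 + √L`. (We use the level `2(m + 2Λ) + 2` instead of
Bamler's `2(n − 2 R_min τ)` to get strict inequalities and a non-degenerate level.)

Everything is proved; no definitions, no named facts. What is NOT here: the existence of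
`H_m`-centres (Bamler 2020a, Prop. 3.13), the Gaussian lemma itself.

## References

* R. H. Bamler, *Entropy and heat kernel bounds on a Ricci flow background*, arXiv:2008.07093
  (2020), §3.1 Prop. 3.11, Prop. 3.13, §5.1 Prop. 5.13, §7.3 (proof of the Gaussian lemma,
  after (7.19)). [Bamler2020Entropy]
-/

noncomputable section

open Set Filter Function MeasureTheory Measure
open scoped Manifold ContDiff Topology ENNReal NNReal

namespace Literature.Geometry.Riemannian

open Lorentzian Lorentzian.PseudoRiemannianMetric

section Kernel2

variable {m : ℕ} {H : Type*} [TopologicalSpace H]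
  {I : ModelWithCorners ℝ (EuclideanSpace ℝ (Fin m)) H} [I.Boundaryless]
  {M : Type*} [TopologicalSpace M] [ChartedSpace H M] [IsManifold I ∞ M]
  [T2Space M] [CompactSpace M] [SecondCountableTopology M] [MeasurableSpace M] [BorelSpace M]
  [ConnectedSpace M] [T3Space M]
  {h : ℝ → PseudoRiemannianMetric I ∞ (EuclideanSpace ℝ (Fin m)) (TangentSpace I : M → Type _)}
  {cov : ℝ → CovariantDerivative I (EuclideanSpace ℝ (Fin m)) (TangentSpace I : M → Type _)}
  {a T : ℝ} (hflow : IsRicciFlow h cov (Icc a T)) (hh : IsContMDiffFamilyOn ∞ h univ)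
  (hR : ∀ r, (h r).IsRiemannian)

/-- **A point near an `H_m`-centre where the kernel is not small** (Bamler 2020a, §7.3, proof of
the Gaussian lemma, the step after (7.19): "by combining Propositions 3.13, 5.13 we obtain that
there is a point `y₂ ∈ B(z,0,√(2H_n))` with `(f(y₂) − 𝒩* − n/2)² ≤ 2(n − 2R_min τ)`. Thus
`K(x,1;y₂,0) ≥ c exp(−𝒩*)`"). For the conjugate heat kernel `K(x,t;·,s) = (4πτ)^{-m/2} e^{-f}`,
`τ = t − s`, of a Ricci flow on a closed manifold (`m ≥ 3`), `R(·, s) ≥ R_min`, `−R_min τ ≤ Λ`,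
`0 ≤ Λ`, and an `H_m`-centre `z` of `(x, t)` at time `s` (`∫ d_s(z,·)² dν_{x,t;s} ≤ H_m τ`),
some `y₂` with `d_s(z, y₂) < √(2 H_m τ)` has
`K(x,t;y₂,s) ≥ (4πτ)^{-m/2} exp(−𝒩 − m/2 − √(2m + 4Λ + 2))`: Chebyshev for the ball (mass
`≥ 1/2`), Markov for `(f − 𝒩 − m/2)²` (Prop. 5.13: `ν`-mean `≤ m − 2 R_min τ ≤ m + 2Λ`) at level
`2m + 4Λ + 2` (mass of the strict sublevel set `> 1/2`), and the two sets intersect.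
[cite: Bamler2020Entropy, §7.3, proof of the Gaussian lemma, after (7.19)] -/
theorem exists_near_hCenter_le_heatKernelFn (hm : 3 ≤ m) {s t : ℝ} (has : a < s) (hst : s < t)
    (htT : t ≤ T) {Rmin Λ : ℝ} (hRmin : ∀ y, Rmin ≤ (h s).scalarCurvatureWith (cov s) y)
    (hΛ : 0 ≤ Λ) (hRΛ : -Rmin * (t - s) ≤ Λ) (x z : M)
    (hz : ∫⁻ w, (h s).edist (hR s) z w ^ 2 ∂(heatKernelMeasure hh hR t x s) ≤
      ENNReal.ofReal ((((m : ℝ) - 1) * Real.pi ^ 2 / 2 + 4) * (t - s))) :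
    ∃ y₂ : M, (h s).edist (hR s) z y₂ <
        ENNReal.ofReal (Real.sqrt (2 * ((((m : ℝ) - 1) * Real.pi ^ 2 / 2 + 4) * (t - s)))) ∧
      (4 * Real.pi * (t - s)) ^ (-(m : ℝ) / 2) *
          Real.exp (-(pointedNashEntropy h (fun r' v ↦ hflow.heatKernelFn hh hR t x (v, r')) m t s)
            - (m : ℝ) / 2 - Real.sqrt (2 * (m : ℝ) + 4 * Λ + 2)) ≤
        hflow.heatKernelFn hh hR t x (y₂, s) := by
  have ht : t ∈ Ioc a T := ⟨has.trans hst, htT⟩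
  have hs : s ∈ Ioo a t := ⟨has, hst⟩
  have hτ : 0 < t - s := sub_pos.2 hst
  have hmR : (3 : ℝ) ≤ m := by exact_mod_cast hm
  -- abbreviations
  set ν : Measure M := heatKernelMeasure hh hR t x s with hν
  set u : ℝ → M → ℝ := fun r' v ↦ hflow.heatKernelFn hh hR t x (v, r') with hu
  set N : ℝ := pointedNashEntropy h u m t s with hN
  set c : ℝ := (((m : ℝ) - 1) * Real.pi ^ 2 / 2 + 4) * (t - s) with hc
  set L : ℝ := 2 * (m : ℝ) + 4 * Λ + 2 with hL
  set φ : M → ℝ := fun y ↦ (entropyPotential u m t s y - (N + (m : ℝ) / 2)) ^ 2 with hφ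
  -- the kernel slice and its potential
  have hKpos : ∀ y, 0 < u s y := fun y ↦ hflow.heatKernelFn_pos hh hR ht x ⟨mem_univ _, hs⟩
  have hKc : Continuous (u s) := hflow.continuous_heatKernelFn_slice hh hR ht x hs
  have hfc : Continuous (entropyPotential u m t s) := by
    show Continuous fun y ↦ -Real.log (u s y) - (m : ℝ) / 2 * Real.log (4 * Real.pi * (t - s))
    exact ((hKc.log fun y ↦ (hKpos y).ne').neg).sub continuous_const
  have hφc : Continuous φ := (hfc.sub continuous_const).pow 2
  have hφi : Integrable φ ν :=
    hφc.integrable_of_hasCompactSupport (HasCompactSupport.of_compactSpace _)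
  have hφnn : 0 ≤ᵐ[ν] φ := Eventually.of_forall fun y ↦ sq_nonneg _
  -- (a) Chebyshev: the closed complement of the ball has mass `≤ 1/2`
  have hcont : Continuous fun y ↦ (h s).edist (hR s) z y :=
    ((h s).continuous_edist (hR s)).comp (.prodMk_right z)
  set S : Set M := {y | ENNReal.ofReal (Real.sqrt (2 * c)) ≤ (h s).edist (hR s) z y} with hS
  have hSm : MeasurableSet S := measurableSet_le measurable_const hcont.measurable
  have hc0 : 0 < c := by
    have h1 : (0 : ℝ) ≤ ((m : ℝ) - 1) * Real.pi ^ 2 / 2 :=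
      div_nonneg (mul_nonneg (by linarith) (sq_nonneg _)) zero_le_two
    have h2 : (0 : ℝ) < ((m : ℝ) - 1) * Real.pi ^ 2 / 2 + 4 := by linarith
    exact mul_pos h2 hτ
  have hSν : ν S ≤ 2⁻¹ := measure_setOf_sqrt_le_le_half ν hcont hc0 hz
  have hSreal : ν.real S ≤ 2⁻¹ := by
    rw [measureReal_def]
    have := ENNReal.toReal_mono (by simp) hSν
    simpa using this
  have hScreal : 2⁻¹ ≤ ν.real Sᶜ := by
    have hsum := measureReal_add_measureReal_compl (μ := ν) hSm
    rw [probReal_univ] at hsum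
    linarith
  -- (b) Markov for `(f − 𝒩 − m/2)²` at level `L`, using Bamler's Prop. 5.13
  have hint : ∫ y, φ y ∂ν ≤ (m : ℝ) - 2 * Rmin * (t - s) := by
    rw [hν, hflow.integral_heatKernelMeasure_eq_integral_mul_heatKernelFn hh hR ht x hs φ]
    exact hflow.integral_sq_entropyPotential_sub_kernel_le hh hR hm ht x hs hRmin
  have hL0 : 0 < L := by
    rw [hL]
    linarith
  have hmarkov := mul_meas_ge_le_integral_of_nonneg hφnn hφi L
  have hTreal : ν.real {y | L ≤ φ y} < 2⁻¹ := by
    have h1 : L * ν.real {y | L ≤ φ y} < L * 2⁻¹ := by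
      have h2 : (m : ℝ) - 2 * Rmin * (t - s) < L * 2⁻¹ := by
        rw [hL]
        linarith
      exact (hmarkov.trans hint).trans_lt h2
    exact lt_of_mul_lt_mul_left h1 hL0.le
  -- (c) the open ball and the strict sublevel set intersect
  have hmeet : ∃ y, y ∈ Sᶜ ∧ φ y < L := by
    by_contra hcon
    push Not at hcon
    have hsub : Sᶜ ⊆ {y | L ≤ φ y} := fun y hy ↦ hcon y hy
    have hmono : ν.real Sᶜ ≤ ν.real {y | L ≤ φ y} := measureReal_mono hsub
    linarith
  obtain ⟨y₂, hyS, hyL⟩ := hmeet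
  refine ⟨y₂, ?_, ?_⟩
  · simpa only [hS, mem_compl_iff, mem_setOf_eq, not_le] using hyS
  -- (d) at `y₂`: `f(y₂) < 𝒩 + m/2 + √L`, i.e. the kernel bound
  have hfy : entropyPotential u m t s y₂ - (N + (m : ℝ) / 2) < Real.sqrt L :=
    Real.lt_sqrt_of_sq_lt hyL
  have hfy' : entropyPotential u m t s y₂ =
      -Real.log (u s y₂) - (m : ℝ) / 2 * Real.log (4 * Real.pi * (t - s)) := rfl
  rw [hfy'] at hfy
  have h4 : 0 < 4 * Real.pi * (t - s) := by
    have hπ := Real.pi_pos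
    positivity
  rw [Real.rpow_def_of_pos h4, ← Real.exp_add]
  calc Real.exp (Real.log (4 * Real.pi * (t - s)) * (-(m : ℝ) / 2) +
        (-N - (m : ℝ) / 2 - Real.sqrt L))
      ≤ Real.exp (Real.log (u s y₂)) := by
        refine Real.exp_le_exp.2 ?_
        linarith [hfy]
    _ = u s y₂ := Real.exp_log (hKpos y₂)

end Kernel2

end Literature.Geometry.Riemannian

end
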